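import Summits.HubbardSuperconductivity.HubbardSuperconductivity.Theorems.AnisotropyChordTransferFibre3FinX3Eval

/-!
# Route `AnisotropyChord` / H0 rotor rung: FIN per-`L` GM₃ (X5), `L = 35` — rows `N₁` / D / side-condition cell facts, part `p53`

Kernel facts (`decide +kernel`) for cert cells 126, 127 of the per-`L` grid of `L = 35`: `xbnCellAny2` (row `N₁` on XB2 point wedges recomputed in the kernel, exporting the literal brackets `nt ⊇ T⁺ − 3λ₂` and `tb ⊇ T⁺·D`), `xdCellAnyN0` (row D, reads `nt`), `sdCellAnyZN` (side condition, reads `nt`); evaluators `…FinX3Eval` / `…FinX5Eval`; constants from the compiled design probe (x3probe/x3plan, margins c ×0.985, b ×1.03, aD ×1.03); assembled in `…FinX5GM3ThirtyFive`.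
Prover seat `hubbard-h0-rotor-p3` g8; helper for piece A = stmt-HubbardSuperconductivity-23918 of rung 19089 (`--supports`, helper class).
WHAT THIS IS NOT: nothing here proves superconductivity in the Hubbard model (rotor TARGET as worded stays FALSE, g15 verdict); kernel facts for the FIN certificate of ONE conditional reduction.  Tree imports only; zero data; standard axioms.
-/

set_option linter.dupNamespace false
set_option autoImplicit false

namespace Summit.HubbardSuperconductivity.HubbardSuperconductivity.Theorems.AnisotropyChord.Transfer.Fibre3

namespace FinXD

open FinXB FinCell Hole2

set_option maxHeartbeats 4000000 in
/-- row `N₁` of cell 126 of `L = 35` (`c = 23/40`), exporting `nt`, `tb`. [folklore] -/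
theorem xn35_126 : xbnCellAny2 35 (49/50 : ℚ) 955488108200820 979375310905841 (23/40 : ℚ) ((15910868274016 : ℤ), (22358624781172 : ℤ)) ((2882357697366683 : ℤ), (2960502053008488 : ℤ)) = true := by decide +kernel

set_option maxHeartbeats 4000000 in
/-- row D of cell 126 of `L = 35` (`aD = 79/1000`). [folklore] -/
theorem xd35_126 : xdCellAnyN0 35 (49/50 : ℚ) 955488108200820 979375310905841 (79/1000 : ℚ) ((15910868274016 : ℤ), (22358624781172 : ℤ)) = true := by decide +kernel

set_option maxHeartbeats 4000000 in
/-- side condition of cell 126 of `L = 35` (`c, b = 109/100, aD`). [folklore] -/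
theorem sd35_126 : sdCellAnyZN 35 (49/50 : ℚ) 100 955488108200820 979375310905841 ((23/40 : ℚ), (109 : ℕ), (79/1000 : ℚ)) ((15910868274016 : ℤ), (22358624781172 : ℤ)) = true := by decide +kernel

set_option maxHeartbeats 4000000 in
/-- row `N₁` of cell 127 of `L = 35` (`c = 23/40`), exporting `nt`, `tb`. [folklore] -/
theorem xn35_127 : xbnCellAny2 35 (49/50 : ℚ) 979375310905841 1003859693678487 (23/40 : ℚ) ((17049949685649 : ℤ), (23937810276500 : ℤ)) ((2955157949505634 : ℤ), (3035534824209499 : ℤ)) = true := by decide +kernel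

set_option maxHeartbeats 4000000 in
/-- row D of cell 127 of `L = 35` (`aD = 79/1000`). [folklore] -/
theorem xd35_127 : xdCellAnyN0 35 (49/50 : ℚ) 979375310905841 1003859693678487 (79/1000 : ℚ) ((17049949685649 : ℤ), (23937810276500 : ℤ)) = true := by decide +kernel

set_option maxHeartbeats 4000000 in
/-- side condition of cell 127 of `L = 35` (`c, b = 111/100, aD`). [folklore] -/
theorem sd35_127 : sdCellAnyZN 35 (49/50 : ℚ) 100 979375310905841 1003859693678487 ((23/40 : ℚ), (111 : ℕ), (79/1000 : ℚ)) ((17049949685649 : ℤ), (23937810276500 : ℤ)) = true := by decide +kernel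

end FinXD

end Summit.HubbardSuperconductivity.HubbardSuperconductivity.Theorems.AnisotropyChord.Transfer.Fibre3
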